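import Mathlib.Combinatorics.SimpleGraph.Finite
import Mathlib.Combinatorics.SimpleGraph.Connectivity.Connected
import Mathlib.Combinatorics.SimpleGraph.Maps
import Mathlib.Data.Sym.Sym2
import Mathlib.Data.Fintype.Sum
import Literature.Combinatorics.SimpleGraph.SubcubicMinors
import HarnessLib

/-!
# Subdividing the edges of a graph into paths of prescribed lengths

Topic `Literature/Combinatorics/SimpleGraph`.  Diestel (§1.7): a *subdivision* `TX` of a graph `X` is obtained by
replacing the edges of `X` by independent paths between their ends; `G` contains a `TX` iff `X` is a topological minor of
`G` (the tree's `IsTopologicalMinor`, `WallTopologicalMinor.lean`).  The tree has the ONE-edge subdivision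
(`HamiltonianSubdivision.subdivide`) and the uniform 2-subdivision of a graph on `Fin v`
(`ModelTheory/FiniteModelTheory/CFIUncolouredProofs.lean`, `ChenFlumLiu2025.subdiv`, the host of the CFI projection).  This
file provides the general construction with a PRESCRIBED number `ℓ e` of new vertices on every edge `e` (so `ℓ = 0` keeps the
edge, `ℓ = 2` is the 2-subdivision), as one `SimpleGraph` on a vertex type whose `Fintype`/`DecidableEq` instances are
inferred:

* `PSubdivVertex G ℓ M = α ⊕ {(e, i) : Sym2 α × Fin M // e ∈ E(G), i < ℓ e}` — the old vertices and, for every edge `e`, its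
  new vertices `(e, 0), …, (e, ℓ e - 1)` listed from the end `(edgeOut e).1` (a fixed choice of orientation, `Quot.out`)
  towards `(edgeOut e).2`; `M` is a uniform a-priori bound on the `ℓ e` (positions live in `Fin M`; the construction is the
  intended one when `ℓ e ≤ M` on edges, which the structural lemmas assume where needed);
* `psubdiv G ℓ M` — the subdivided graph: `u — (e,0) — (e,1) — ⋯ — (e, ℓ e - 1) — w` along every edge `e = uw` with
  `(edgeOut e) = (u, w)`, and the edge `uw` itself when `ℓ e = 0`;
* adjacency lemmas `psubdiv_adj_inl_inl / inl_inr / inr_inl / inr_inr`;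
* `psubdiv_neighbors_le_three` — subdividing a graph with `≤ 3` neighbours per vertex keeps that property (the form consumed
  by `IsMinor.isTopologicalMinor_of_neighbors_le_three`);
* `reachable_inl_of_adj`, `psubdiv_connected` — connected graphs have connected subdivisions (`ℓ ≤ M` on edges);
* `isMinor_psubdiv` — **`G ≼ₘ psubdiv G ℓ M`** (contract the new vertices of `e` onto the end `(edgeOut e).1`; `ℓ ≤ M`).

Not here: the isomorphism with `ChenFlumLiu2025.subdiv` for `ℓ = 2`, tree-width invariance, and embeddings of subdivided
walls into grids (consumers' business). [cite: Diestel2010, §1.7 (subdivisions, topological minors)]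
-/

namespace Literature.Combinatorics.SimpleGraph

open _root_.SimpleGraph

variable {α : Type*}

/-! ### A fixed orientation of every unordered pair -/

/-- A chosen ordered representative of an unordered pair (`Quot.out`): the subdivision path of the edge `e` is listed from
`(edgeOut e).1` to `(edgeOut e).2`. [folklore] -/
noncomputable def edgeOut (e : Sym2 α) : α × α := Quot.out e

/-- The chosen representative represents. [cite: Diestel2010, §1.7 (subdivisions: the path of an edge runs between its two ends)] -/
@[simp] theorem edgeOut_mk (e : Sym2 α) : s((edgeOut e).1, (edgeOut e).2) = e := Quot.out_eq e

/-- Membership in an unordered pair in terms of the chosen representative. [cite: Diestel2010, §1.7 (subdivisions)] -/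
theorem mem_iff_edgeOut {e : Sym2 α} {u : α} : u ∈ e ↔ u = (edgeOut e).1 ∨ u = (edgeOut e).2 := by
  conv_lhs => rw [← edgeOut_mk e]
  exact Sym2.mem_iff

/-- The two chosen ends of an edge of a simple graph are adjacent (in particular distinct). [cite: Diestel2010, §1.7 (subdivisions)] -/
theorem adj_edgeOut {G : SimpleGraph α} {e : Sym2 α} (he : e ∈ G.edgeSet) : G.Adj (edgeOut e).1 (edgeOut e).2 := by
  rw [← edgeOut_mk e, SimpleGraph.mem_edgeSet] at he
  exact he

/-! ### The subdivided graph -/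

/-- The vertices of the `ℓ`-subdivision of `G` with position bound `M`: the old vertices `inl u`, and the new vertices
`inr ⟨(e, i), _⟩`, `e` an edge of `G`, `i < ℓ e` (and `i < M`), the `(i+1)`-st inner vertex of the path of `e` counted from
`(edgeOut e).1`. [cite: Diestel2010, §1.7 (subdivisions)] -/
abbrev PSubdivVertex (G : SimpleGraph α) (ℓ : Sym2 α → ℕ) (M : ℕ) : Type _ :=
  α ⊕ {p : Sym2 α × Fin M // p.1 ∈ G.edgeSet ∧ (p.2 : ℕ) < ℓ p.1}

/-- The generating (directed) adjacency of the subdivision: `u → (e, 0)` for `u = (edgeOut e).1`, `(e, ℓ e - 1) ← w` for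
`w = (edgeOut e).2`, consecutive inner vertices `(e, i) → (e, i+1)`, and the old edge `u w` when `ℓ (uw) = 0`.  Symmetrised
by `SimpleGraph.fromRel` in `psubdiv`. [cite: Diestel2010, §1.7 (subdivisions)] -/
def psubdivRel (G : SimpleGraph α) (ℓ : Sym2 α → ℕ) (M : ℕ) : PSubdivVertex G ℓ M → PSubdivVertex G ℓ M → Prop
  | .inl u, .inl w => G.Adj u w ∧ ℓ s(u, w) = 0
  | .inl u, .inr x => (u = (edgeOut x.1.1).1 ∧ (x.1.2 : ℕ) = 0) ∨ (u = (edgeOut x.1.1).2 ∧ (x.1.2 : ℕ) + 1 = ℓ x.1.1)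
  | .inr x, .inr y => x.1.1 = y.1.1 ∧ (x.1.2 : ℕ) + 1 = y.1.2
  | .inr _, .inl _ => False

/-- **The `ℓ`-subdivision `psubdiv G ℓ M` of `G`**: every edge `e` of `G` is replaced by a path with `ℓ e` new inner vertices
(`ℓ e + 1` edges; the edge itself when `ℓ e = 0`), the paths being independent.  Intended regime: `ℓ e ≤ M` for the edges of
`G`. [cite: Diestel2010, §1.7 (subdivisions)] -/
def psubdiv (G : SimpleGraph α) (ℓ : Sym2 α → ℕ) (M : ℕ) : SimpleGraph (PSubdivVertex G ℓ M) :=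
  SimpleGraph.fromRel (psubdivRel G ℓ M)

variable {G : SimpleGraph α} {ℓ : Sym2 α → ℕ} {M : ℕ}

/-- Old vertices are adjacent in the subdivision iff they are adjacent in `G` and their edge is not subdivided.
[cite: Diestel2010, §1.7 (subdivisions)] -/
theorem psubdiv_adj_inl_inl {u w : α} : (psubdiv G ℓ M).Adj (.inl u) (.inl w) ↔ G.Adj u w ∧ ℓ s(u, w) = 0 := by
  simp only [psubdiv, SimpleGraph.fromRel_adj, ne_eq, Sum.inl.injEq, psubdivRel]
  constructor
  · rintro ⟨-, h | h⟩
    · exact h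
    · rw [Sym2.eq_swap]; exact ⟨h.1.symm, h.2⟩
  · intro h
    exact ⟨h.1.ne, Or.inl h⟩

/-- An old vertex `u` is adjacent to the inner vertex `(e, i)` iff `u` is the first chosen end of `e` and `i = 0`, or the
second chosen end and `i = ℓ e - 1`. [cite: Diestel2010, §1.7 (subdivisions)] -/
theorem psubdiv_adj_inl_inr {u : α} {x : {p : Sym2 α × Fin M // p.1 ∈ G.edgeSet ∧ (p.2 : ℕ) < ℓ p.1}} :
    (psubdiv G ℓ M).Adj (.inl u) (.inr x) ↔
      (u = (edgeOut x.1.1).1 ∧ (x.1.2 : ℕ) = 0) ∨ (u = (edgeOut x.1.1).2 ∧ (x.1.2 : ℕ) + 1 = ℓ x.1.1) := by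
  simp only [psubdiv, SimpleGraph.fromRel_adj, ne_eq, reduceCtorEq, not_false_eq_true, true_and, psubdivRel, or_false]

/-- Symmetric form of `psubdiv_adj_inl_inr`. [cite: Diestel2010, §1.7 (subdivisions)] -/
theorem psubdiv_adj_inr_inl {u : α} {x : {p : Sym2 α × Fin M // p.1 ∈ G.edgeSet ∧ (p.2 : ℕ) < ℓ p.1}} :
    (psubdiv G ℓ M).Adj (.inr x) (.inl u) ↔
      (u = (edgeOut x.1.1).1 ∧ (x.1.2 : ℕ) = 0) ∨ (u = (edgeOut x.1.1).2 ∧ (x.1.2 : ℕ) + 1 = ℓ x.1.1) := by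
  rw [SimpleGraph.adj_comm, psubdiv_adj_inl_inr]

/-- Inner vertices are adjacent iff they lie on the same edge in consecutive positions.
[cite: Diestel2010, §1.7 (subdivisions)] -/
theorem psubdiv_adj_inr_inr {x y : {p : Sym2 α × Fin M // p.1 ∈ G.edgeSet ∧ (p.2 : ℕ) < ℓ p.1}} :
    (psubdiv G ℓ M).Adj (.inr x) (.inr y) ↔
      x.1.1 = y.1.1 ∧ ((x.1.2 : ℕ) + 1 = y.1.2 ∨ (y.1.2 : ℕ) + 1 = x.1.2) := by
  simp only [psubdiv, SimpleGraph.fromRel_adj, ne_eq, Sum.inr.injEq, psubdivRel]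
  constructor
  · rintro ⟨-, h | h⟩
    · exact ⟨h.1, Or.inl h.2⟩
    · exact ⟨h.1.symm, Or.inr h.2⟩
  · rintro ⟨he, h | h⟩
    · refine ⟨fun hxy => ?_, Or.inl ⟨he, h⟩⟩
      rw [hxy] at h; omega
    · refine ⟨fun hxy => ?_, Or.inr ⟨he.symm, h⟩⟩
      rw [hxy] at h; omega

/-- Two inner vertices with the same edge and the same position are equal. [cite: Diestel2010, §1.7 (subdivisions)] -/
theorem inner_ext {x y : {p : Sym2 α × Fin M // p.1 ∈ G.edgeSet ∧ (p.2 : ℕ) < ℓ p.1}} (he : x.1.1 = y.1.1)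
    (hi : (x.1.2 : ℕ) = y.1.2) : x = y :=
  Subtype.ext (Prod.ext he (Fin.ext hi))

/-! ### Degrees: subdividing keeps "at most three neighbours" -/

/-- **Subdivision preserves the bound "every vertex has at most three neighbours"** (old vertices keep one neighbour per
incident edge, inner vertices have two) — the hypothesis of the tree's `IsMinor.isTopologicalMinor_of_neighbors_le_three`.
[cite: Diestel2010, §1.7 (subdivisions; Prop. 1.7.2 (ii))] -/
theorem psubdiv_neighbors_le_three [DecidableEq α]
    (h3 : ∀ u : α, ∃ l : List α, l.length ≤ 3 ∧ ∀ v, G.Adj u v → v ∈ l) :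
    ∀ a : PSubdivVertex G ℓ M, ∃ l : List (PSubdivVertex G ℓ M), l.length ≤ 3 ∧
      ∀ b, (psubdiv G ℓ M).Adj a b → b ∈ l := by
  classical
  rintro (u | x)
  · -- old vertex: one neighbour per `G`-neighbour
    obtain ⟨l, hl, hmem⟩ := h3 u
    -- the subdivision-neighbour of `u` towards `w`
    let f : α → PSubdivVertex G ℓ M := fun w =>
      if h : G.Adj u w ∧ 0 < ℓ s(u, w) ∧ 0 < M then
        if hu : u = (edgeOut s(u, w)).1 then
          .inr ⟨(s(u, w), ⟨0, h.2.2⟩), (SimpleGraph.mem_edgeSet G).2 h.1, h.2.1⟩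
        else if hM : ℓ s(u, w) - 1 < M then
          .inr ⟨(s(u, w), ⟨ℓ s(u, w) - 1, hM⟩), (SimpleGraph.mem_edgeSet G).2 h.1, by simp only; omega⟩
        else .inl w
      else .inl w
    refine ⟨l.map f, by simpa using hl, ?_⟩
    rintro (w | y) hb
    · rw [psubdiv_adj_inl_inl] at hb
      refine List.mem_map.2 ⟨w, hmem w hb.1, ?_⟩
      simp only [f, hb.2, lt_self_iff_false, false_and, and_false, dif_neg, not_false_eq_true]
    · rw [psubdiv_adj_inl_inr] at hb
      obtain ⟨⟨e, i⟩, he, hi⟩ := y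
      simp only at hb hi
      have hadj := adj_edgeOut he
      have hM : 0 < M := lt_of_le_of_lt (Nat.zero_le _) i.is_lt
      rcases hb with ⟨hu, hi0⟩ | ⟨hu, hi1⟩
      · -- `u` is the first end, `i = 0`; the neighbour is `f` of the second end
        refine List.mem_map.2 ⟨(edgeOut e).2, hmem _ (hu ▸ hadj), ?_⟩
        have hsw : s(u, (edgeOut e).2) = e := by rw [hu, edgeOut_mk]
        have hcond : G.Adj u (edgeOut e).2 ∧ 0 < ℓ s(u, (edgeOut e).2) ∧ 0 < M := ⟨hu ▸ hadj, by rw [hsw]; omega, hM⟩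
        simp only [f, dif_pos hcond]
        rw [dif_pos (by rw [hsw]; exact hu)]
        congr 1
        exact inner_ext (by simp [hsw]) (by simp [hi0])
      · -- `u` is the second end, `i = ℓ e - 1`; the neighbour is `f` of the first end
        refine List.mem_map.2 ⟨(edgeOut e).1, hmem _ (hu ▸ hadj.symm), ?_⟩
        have hsw : s(u, (edgeOut e).1) = e := by rw [hu, Sym2.eq_swap, edgeOut_mk]
        have hcond : G.Adj u (edgeOut e).1 ∧ 0 < ℓ s(u, (edgeOut e).1) ∧ 0 < M :=
          ⟨hu ▸ hadj.symm, by rw [hsw]; omega, hM⟩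
        have hne : ¬ u = (edgeOut s(u, (edgeOut e).1)).1 := by
          rw [hsw, hu]; exact fun h => hadj.ne h.symm
        have hM' : ℓ s(u, (edgeOut e).1) - 1 < M := by rw [hsw]; omega
        simp only [f, dif_pos hcond, dif_neg hne, dif_pos hM']
        congr 1
        exact inner_ext (by simp [hsw]) (by simp [hsw]; omega)
  · -- inner vertex: the previous and the next vertex on its path
    obtain ⟨⟨e, i⟩, he, hi⟩ := x
    simp only at hi
    let lower : PSubdivVertex G ℓ M :=
      if h0 : (i : ℕ) = 0 then .inl (edgeOut e).1
      else .inr ⟨(e, ⟨i - 1, by omega⟩), he, by simp only; omega⟩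
    let upper : PSubdivVertex G ℓ M :=
      if h1 : (i : ℕ) + 1 < ℓ e ∧ (i : ℕ) + 1 < M then .inr ⟨(e, ⟨i + 1, h1.2⟩), he, h1.1⟩
      else .inl (edgeOut e).2
    refine ⟨[lower, upper], by simp, ?_⟩
    rintro (w | y) hb
    · rw [psubdiv_adj_inr_inl] at hb
      simp only at hb
      rcases hb with ⟨hw, hi0⟩ | ⟨hw, hi1⟩
      · have : lower = .inl w := by simp only [lower, dif_pos hi0, hw]
        simp [this]
      · have : upper = .inl w := by
          simp only [upper, hw]
          rw [dif_neg (by omega)]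
        simp [this]
    · rw [psubdiv_adj_inr_inr] at hb
      obtain ⟨⟨e', j⟩, he', hj⟩ := y
      simp only at hb hj
      obtain ⟨rfl, hij | hji⟩ := hb
      · have h1 : (i : ℕ) + 1 < ℓ e ∧ (i : ℕ) + 1 < M := ⟨by omega, by omega⟩
        have : upper = .inr ⟨(e, j), he', hj⟩ := by
          simp only [upper, dif_pos h1]
          congr 1
          exact inner_ext rfl (by simp [hij])
        simp [this]
      · have h0 : ¬ (i : ℕ) = 0 := by omega
        have : lower = .inr ⟨(e, j), he', hj⟩ := by
          simp only [lower, dif_neg h0]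
          congr 1
          exact inner_ext rfl (by simp; omega)
        simp [this]

/-! ### Connectivity -/

/-- Every inner vertex of the path of `e` is reachable from the first chosen end of `e` (walk down the path).
[cite: Diestel2010, §1.7 (subdivisions)] -/
theorem reachable_inl_inr (x : {p : Sym2 α × Fin M // p.1 ∈ G.edgeSet ∧ (p.2 : ℕ) < ℓ p.1}) :
    (psubdiv G ℓ M).Reachable (.inl (edgeOut x.1.1).1) (.inr x) := by
  obtain ⟨⟨e, i⟩, he, hi⟩ := x
  simp only at hi ⊢
  -- induction on the position
  suffices h : ∀ n (hn : n < M) (hn' : n < ℓ e),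
      (psubdiv G ℓ M).Reachable (.inl (edgeOut e).1) (.inr ⟨(e, ⟨n, hn⟩), he, hn'⟩) from h i i.is_lt hi
  intro n
  induction n with
  | zero =>
    intro hn hn'
    exact SimpleGraph.Adj.reachable (psubdiv_adj_inl_inr.2 (Or.inl ⟨rfl, rfl⟩))
  | succ n ih =>
    intro hn hn'
    refine (ih (by omega) (by omega)).trans (SimpleGraph.Adj.reachable (psubdiv_adj_inr_inr.2 ⟨rfl, Or.inl ?_⟩))
    simp

/-- The two ends of an edge of `G` are joined in the subdivision (along the path of the edge; needs `ℓ e ≤ M`).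
[cite: Diestel2010, §1.7 (subdivisions)] -/
theorem reachable_inl_of_adj {u w : α} (huw : G.Adj u w) (hM : ℓ s(u, w) ≤ M) :
    (psubdiv G ℓ M).Reachable (.inl u) (.inl w) := by
  -- reduce to the chosen orientation of the edge
  suffices key : ∀ e ∈ G.edgeSet, ℓ e ≤ M →
      (psubdiv G ℓ M).Reachable (.inl (edgeOut e).1) (.inl (edgeOut e).2) by
    have he : s(u, w) ∈ G.edgeSet := (SimpleGraph.mem_edgeSet G).2 huw
    have h := key _ he hM
    rcases (mem_iff_edgeOut (e := s(u, w))).1 (Sym2.mem_mk_left u w) with hu | hu <;>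
      rcases (mem_iff_edgeOut (e := s(u, w))).1 (Sym2.mem_mk_right u w) with hw | hw
    · exact absurd (hu.trans hw.symm) huw.ne
    · rw [← hu, ← hw] at h; exact h
    · have h' := h.symm
      rw [← hu, ← hw] at h'; exact h'
    · exact absurd (hu.trans hw.symm) huw.ne
  intro e he hle
  rcases Nat.eq_zero_or_pos (ℓ e) with h0 | hpos
  · refine SimpleGraph.Adj.reachable (psubdiv_adj_inl_inl.2 ⟨adj_edgeOut he, ?_⟩)
    rw [edgeOut_mk]; exact h0
  · -- go to the last inner vertex and then to the second end
    let x : {p : Sym2 α × Fin M // p.1 ∈ G.edgeSet ∧ (p.2 : ℕ) < ℓ p.1} :=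
      ⟨(e, ⟨ℓ e - 1, by omega⟩), he, by simp only; omega⟩
    refine (reachable_inl_inr x).trans (SimpleGraph.Adj.reachable (psubdiv_adj_inr_inl.2 (Or.inr ⟨rfl, ?_⟩)))
    simp only [x]; omega

/-- **Connected graphs have connected subdivisions** (for position bound `M ≥ ℓ e` on the edges).
[cite: Diestel2010, §1.7 (subdivisions)] -/
theorem psubdiv_connected (hconn : G.Connected) (hM : ∀ e ∈ G.edgeSet, ℓ e ≤ M) : (psubdiv G ℓ M).Connected := by
  haveI : Nonempty α := hconn.nonempty
  haveI : Nonempty (PSubdivVertex G ℓ M) := ⟨.inl (Classical.arbitrary α)⟩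
  -- old vertices are mutually reachable
  have hold : ∀ u w : α, (psubdiv G ℓ M).Reachable (.inl u) (.inl w) := by
    intro u w
    obtain ⟨p⟩ := hconn.preconnected u w
    induction p with
    | nil => exact SimpleGraph.Reachable.refl _
    | cons h _ ih => exact (reachable_inl_of_adj h (hM _ ((SimpleGraph.mem_edgeSet G).2 h))).trans ih
  refine SimpleGraph.Connected.mk fun a b => ?_
  -- every vertex is reachable from an old vertex
  have hany : ∀ a : PSubdivVertex G ℓ M, ∃ u : α, (psubdiv G ℓ M).Reachable (.inl u) a := by
    rintro (u | x)
    · exact ⟨u, SimpleGraph.Reachable.refl _⟩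
    · exact ⟨_, reachable_inl_inr x⟩
  obtain ⟨u, hu⟩ := hany a
  obtain ⟨w, hw⟩ := hany b
  exact hu.symm.trans ((hold u w).trans hw)

/-! ### The base graph is a minor of its subdivision -/

/-- **`G ≼ₘ psubdiv G ℓ M`** (position bound `M ≥ ℓ e` on edges): the branch set of `u` is `inl u` together with the inner
vertices of the edges whose first chosen end is `u`; it is a path-star, hence connected, and the last inner vertex of `e` (or
`u` itself when `ℓ e = 0`) is adjacent to the branch set of the other end. [cite: Diestel2010, §1.7 (every `TX` contains an `MX`)] -/
theorem isMinor_psubdiv (hM : ∀ e ∈ G.edgeSet, ℓ e ≤ M) : G ≼ₘ psubdiv G ℓ M := by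
  classical
  let φ : PSubdivVertex G ℓ M → Option α := fun a =>
    match a with
    | .inl u => some u
    | .inr x => some (edgeOut x.1.1).1
  refine ⟨φ, fun u => ⟨.inl u, rfl⟩, ?_, ?_⟩
  · -- branch sets are connected: walk from any member down to `inl u` inside the branch set
    have hdown : ∀ (x : {p : Sym2 α × Fin M // p.1 ∈ G.edgeSet ∧ (p.2 : ℕ) < ℓ p.1}),
        ∃ p : (psubdiv G ℓ M).Walk (.inr x) (.inl (edgeOut x.1.1).1), ∀ z ∈ p.support, φ z = some (edgeOut x.1.1).1 := by
      rintro ⟨⟨e, i⟩, he, hi⟩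
      simp only at hi ⊢
      suffices h : ∀ n (hn : n < M) (hn' : n < ℓ e),
          ∃ p : (psubdiv G ℓ M).Walk (.inr ⟨(e, ⟨n, hn⟩), he, hn'⟩) (.inl (edgeOut e).1),
            ∀ z ∈ p.support, φ z = some (edgeOut e).1 from h i i.is_lt hi
      intro n
      induction n with
      | zero =>
        intro hn hn'
        refine ⟨SimpleGraph.Walk.cons (psubdiv_adj_inr_inl.2 (Or.inl ⟨rfl, rfl⟩)) SimpleGraph.Walk.nil, ?_⟩
        intro z hz
        simp only [SimpleGraph.Walk.support_cons, SimpleGraph.Walk.support_nil, List.mem_cons,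
          List.not_mem_nil, or_false] at hz
        rcases hz with rfl | rfl <;> rfl
      | succ n ih =>
        intro hn hn'
        obtain ⟨p, hp⟩ := ih (by omega) (by omega)
        have hadj : (psubdiv G ℓ M).Adj (.inr ⟨(e, ⟨n + 1, hn⟩), he, hn'⟩)
            (.inr ⟨(e, ⟨n, by omega⟩), he, by simp only; omega⟩) :=
          psubdiv_adj_inr_inr.2 ⟨rfl, Or.inr rfl⟩
        refine ⟨SimpleGraph.Walk.cons hadj p, ?_⟩
        intro z hz
        rw [SimpleGraph.Walk.support_cons, List.mem_cons] at hz
        rcases hz with rfl | hz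
        · rfl
        · exact hp z hz
    have hval : ∀ a u, φ a = some u → ∃ p : (psubdiv G ℓ M).Walk a (.inl u), ∀ z ∈ p.support, φ z = some u := by
      rintro (u' | x) u h
      · simp only [φ, Option.some.injEq] at h
        subst h
        exact ⟨SimpleGraph.Walk.nil, fun z hz => by simp at hz; rw [hz]⟩
      · simp only [φ, Option.some.injEq] at h
        subst h
        exact hdown x
    intro a b hab hne
    obtain ⟨u, hu⟩ := Option.ne_none_iff_exists'.1 hne
    obtain ⟨p, hp⟩ := hval a u hu
    obtain ⟨q, hq⟩ := hval b u (hab ▸ hu)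
    refine ⟨p.append q.reverse, fun z hz => ?_⟩
    rw [SimpleGraph.Walk.mem_support_append_iff, SimpleGraph.Walk.support_reverse, List.mem_reverse] at hz
    rw [hu]
    rcases hz with hz | hz
    · exact hp z hz
    · exact hq z hz
  · -- edges of `G` are realised
    intro u w huw
    have he : s(u, w) ∈ G.edgeSet := (SimpleGraph.mem_edgeSet G).2 huw
    rcases Nat.eq_zero_or_pos (ℓ s(u, w)) with h0 | hpos
    · exact ⟨.inl u, .inl w, rfl, rfl, psubdiv_adj_inl_inl.2 ⟨huw, h0⟩⟩
    · -- the last inner vertex of the edge, in the branch set of the first chosen end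
      have hlt : ℓ s(u, w) - 1 < M := by have := hM _ he; omega
      let x : {p : Sym2 α × Fin M // p.1 ∈ G.edgeSet ∧ (p.2 : ℕ) < ℓ p.1} :=
        ⟨(s(u, w), ⟨ℓ s(u, w) - 1, hlt⟩), he, by simp only; omega⟩
      have hx : (psubdiv G ℓ M).Adj (.inr x) (.inl (edgeOut s(u, w)).2) :=
        psubdiv_adj_inr_inl.2 (Or.inr ⟨rfl, by simp only [x]; omega⟩)
      have hφx : φ (.inr x) = some (edgeOut s(u, w)).1 := rfl
      rcases (mem_iff_edgeOut (e := s(u, w))).1 (Sym2.mem_mk_left u w) with hu | hu <;>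
        rcases (mem_iff_edgeOut (e := s(u, w))).1 (Sym2.mem_mk_right u w) with hw | hw
      · exact absurd (hu.trans hw.symm) huw.ne
      · refine ⟨.inr x, .inl w, by rw [hφx, ← hu], rfl, ?_⟩
        rw [← hw] at hx; exact hx
      · refine ⟨.inl u, .inr x, rfl, by rw [hφx, ← hw], ?_⟩
        rw [← hu] at hx; exact hx.symm
      · exact absurd (hu.trans hw.symm) huw.ne

end Literature.Combinatorics.SimpleGraph
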